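import Literature.NumberTheory.LFunctions.WeilExplicit
import Literature.NumberTheory.LFunctions.WeilMellinBounds
import Literature.NumberTheory.LFunctions.WeilMellinInversion
import Literature.NumberTheory.LFunctions.WeilMellinPolyDecay
import Literature.NumberTheory.LFunctions.EulerMaclaurinZeta
import Literature.NumberTheory.LFunctions.NymanBeurlingDirichlet
import Mathlib.Analysis.SpecialFunctions.ImproperIntegrals

/-!
# Stub `stub_zetaLineIntegrable` for crux `SignCone.SignConeOscillatory` (stmt-RiemannHypothesis-16302), line Sketch

Absolute integrability of `y ↦ F̂(1/2 + iy) ζ(1/2 + iy)` for a Weil test function `F`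
(`F̂ = weilMellin F`): the Euler–Maclaurin growth bound
`‖ζ(s)‖ ≤ 1/‖s-1‖ + 1/2 + ‖s‖/12 + ‖s‖‖s+1‖‖s+2‖/48` on `Re s ≥ -1`
(`Literature.NumberTheory.LFunctions.norm_riemannZeta_le_of_neg_one_le_re`) gives the crude bound
`‖ζ(1/2 + iy)‖ ≤ 5 (1 + y²)³`, while `F̂` decays of every polynomial order on the critical line
(`Literature.NumberTheory.LFunctions.norm_weilMellin_le_pow_of_abs_re_le`, order `4`); the product
is `O((1 + y²)⁻¹)`, integrable (`integrable_inv_one_add_sq`), and continuous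
(`Literature.NumberTheory.LFunctions.continuous_riemannZeta_line`, `continuous_weilMellin`).
-/

noncomputable section
set_option linter.dupNamespace false
open scoped BigOperators ComplexConjugate Real
open Complex MeasureTheory Set Filter

namespace Summit.RiemannHypothesis.RiemannHypothesis.Theorems.SignConeOscillatory

open Literature.NumberTheory.LFunctions

/-- **Crude polynomial growth of `ζ` on the critical line**: `‖ζ(1/2 + iy)‖ ≤ 5 (1 + y²)³`
(from `‖ζ(s)‖ ≤ 1/‖s-1‖ + 1/2 + ‖s‖/12 + ‖s‖‖s+1‖‖s+2‖/48` with `‖s - 1‖ ≥ 1/2` and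
`2|y| ≤ 1 + y²`, so `‖s‖, ‖s+1‖, ‖s+2‖ ≤ 3 (1 + y²)`). -/
theorem norm_riemannZeta_half_line_le (y : ℝ) :
    ‖riemannZeta (1 / 2 + y * I)‖ ≤ 5 * (1 + y ^ 2) ^ 3 := by
  set s : ℂ := 1 / 2 + y * I with hs
  have hre : s.re = 1 / 2 := by simp [hs]
  have h := norm_riemannZeta_le_of_neg_one_le_re (s := s) (by rw [hre]; norm_num)
    (one_half_add_ne_one y)
  -- the norms on the line
  have hn : ‖s‖ ≤ 1 / 2 + |y| := by
    calc ‖s‖ ≤ ‖(1 / 2 : ℂ)‖ + ‖(y : ℂ) * I‖ := norm_add_le _ _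
      _ = 1 / 2 + |y| := by simp
  have hn1 : ‖s + 1‖ ≤ 3 / 2 + |y| := by
    calc ‖s + 1‖ ≤ ‖s‖ + ‖(1 : ℂ)‖ := norm_add_le _ _
      _ ≤ 1 / 2 + |y| + 1 := by rw [norm_one]; linarith
      _ = 3 / 2 + |y| := by ring
  have hn2 : ‖s + 2‖ ≤ 5 / 2 + |y| := by
    calc ‖s + 2‖ ≤ ‖s‖ + ‖(2 : ℂ)‖ := norm_add_le _ _
      _ ≤ 1 / 2 + |y| + 2 := by rw [Complex.norm_ofNat]; linarith
      _ = 5 / 2 + |y| := by ring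
  have hm : 1 / 2 ≤ ‖s - 1‖ := by
    have h1 := Complex.abs_re_le_norm (s - 1)
    have h2 : (s - 1).re = -(1 / 2) := by rw [sub_re, hre, one_re]; norm_num
    rw [h2, abs_neg, abs_of_pos (by norm_num : (0 : ℝ) < 1 / 2)] at h1
    exact h1
  have hm' : 1 / ‖s - 1‖ ≤ 2 := by
    have := one_div_le_one_div_of_le (by norm_num : (0 : ℝ) < 1 / 2) hm
    rwa [one_div_one_div] at this
  -- everything against `w = 1 + y²`
  set w : ℝ := 1 + y ^ 2 with hw
  have hu : 2 * |y| ≤ w := by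
    rw [hw]
    nlinarith [abs_nonneg y, sq_abs y, sq_nonneg (|y| - 1)]
  have hw1 : 1 ≤ w := by rw [hw]; nlinarith [sq_nonneg y]
  have hw3 : w ≤ w ^ 3 := by
    have := pow_le_pow_right₀ hw1 (show 1 ≤ 3 by norm_num)
    rwa [pow_one] at this
  have hw3' : 1 ≤ w ^ 3 := one_le_pow₀ hw1
  have hprod : ‖s‖ * ‖s + 1‖ * ‖s + 2‖ ≤ (3 * w) * (3 * w) * (3 * w) := by
    have e0 : ‖s‖ ≤ 3 * w := by linarith
    have e1 : ‖s + 1‖ ≤ 3 * w := by linarith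
    have e2 : ‖s + 2‖ ≤ 3 * w := by linarith
    gcongr
  have hP : 0 ≤ ‖s‖ * ‖s + 1‖ * ‖s + 2‖ := by positivity
  nlinarith [h, hm', hn, hu, hw3, hw3', hprod, hP, norm_nonneg s]

/-- STUB (integrability of `F̂ · ζ` on the critical line): polynomial (cubic) growth of `ζ(1/2+iy)`
(`norm_riemannZeta_le_of_neg_one_le_re`) against decay of every order of `F̂`
(`norm_weilMellin_le_pow_of_abs_re_le`). -/
theorem stub_zetaLineIntegrable :
    ∀ (F : ℝ → ℂ), IsWeilTest F →
      Integrable (fun y : ℝ => weilMellin F (1 / 2 + y * I) * riemannZeta (1 / 2 + y * I)) := by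
  intro F hF
  obtain ⟨D, hD0, hD⟩ := norm_weilMellin_le_pow_of_abs_re_le hF 0 4
  have hcM : Continuous fun y : ℝ => weilMellin F (1 / 2 + y * I) :=
    (continuous_weilMellin hF.1.continuous hF.2).comp (by fun_prop)
  refine Integrable.mono' (integrable_inv_one_add_sq.const_mul (D * 5))
    (hcM.mul continuous_riemannZeta_line).aestronglyMeasurable
    (Eventually.of_forall fun y => ?_)
  have hpos : 0 < 1 + y ^ 2 := by positivity
  have h1 : ‖weilMellin F (1 / 2 + y * I)‖ ≤ D / (1 + y ^ 2) ^ 4 := by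
    have := hD (1 / 2 + y * I) (by simp)
    simpa using this
  have h2 := norm_riemannZeta_half_line_le y
  rw [norm_mul]
  calc ‖weilMellin F (1 / 2 + y * I)‖ * ‖riemannZeta (1 / 2 + y * I)‖
      ≤ D / (1 + y ^ 2) ^ 4 * (5 * (1 + y ^ 2) ^ 3) :=
        mul_le_mul h1 h2 (norm_nonneg _) (by positivity)
    _ = D * 5 * (1 + y ^ 2)⁻¹ := by field_simp

/-- Convenience (curried) form of `stub_zetaLineIntegrable`. -/
theorem integrable_weilMellin_mul_riemannZeta_half_line {F : ℝ → ℂ} (hF : IsWeilTest F) :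
    Integrable (fun y : ℝ => weilMellin F (1 / 2 + y * I) * riemannZeta (1 / 2 + y * I)) :=
  stub_zetaLineIntegrable F hF

end Summit.RiemannHypothesis.RiemannHypothesis.Theorems.SignConeOscillatory
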